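import Summits.QuantumAdvantage.QuantumAdvantage.Theorems.CubicForrelationSignedCubicForrelationInPrBPPDefectIsotropic
import Literature.Computability.QuantumComplexity.ForrelationCosetAffineBound
import Literature.Computability.QuantumComplexity.ForrelationDirectSum
import HarnessLib

/-!
# Item `CubicForrelation.SignedCubicForrelationInPrBPP` (stmt-QuantumAdvantage-13933) — M-defect toolkit, II

Second of three support files (see `…DefectIsotropic.lean` for the context). Main results:

* `exists_factors_of_affine_on_cosets_directSum` — **sub-multiplicativity of M-subspaces under direct sums**: if the
  direct sum `G = F ⊕ f₀` (on `N + n₀` bits) is affine on every coset of a `⊕`-closed `V ∋ 0`, then `|V| ≤ |V₁|·|V₂|`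
  for some `⊕`-closed `V₁ ∋ 0`, `V₂ ∋ 0` on whose cosets `F` resp. `f₀` are affine. (The block second differences of
  `G` along `V` are equal, hence constant; they define a symmetric alternating right-additive form `c` on `V` whose
  radical contains `V ∩ (𝔽₂^N ⊕ 0) ⊕ V ∩ (0 ⊕ 𝔽₂^{n₀})`; project a large isotropic subgroup
  (`exists_isotropic_subgroup`) to the two blocks and count fibres.) Consequently the M-DEFECT
  `n/2 − max dim V` is super-additive under `⊕`.
* `exists_halfdim_of_partner` — McFarland duality in M-subspace form: for `Φ(a,b) = ±1`, a half-dimensional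
  M-subspace of `b` yields one (`V^⊥`) of `a` (from the landed `dual_affine_on_perp_cosets`).
* `card_MSubspace_le_of_no_halfdim` — if `Φ(f,g) = 1` on `m+m` bits and `g` has no half-dimensional M-subspace then
  every M-subspace of `g` AND of `f` has `≤ 2^m/2` elements (`|V|` is a power of two, `|Φ|·|V| ≤ 2^m`, duality).

References: C. Carlet, Boolean Functions for Cryptography and Coding Theory (CUP 2021), Prop. 54 and Prop. 77;
S. Aaronson, A. Ambainis, Forrelation, SIAM J. Comput. 47 (2018), §1.1.1.
-/

noncomputable section

set_option linter.dupNamespace false -- D-0017: single-problem summit ⇒ `QuantumAdvantage.QuantumAdvantage` by design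

namespace Summit.QuantumAdvantage.QuantumAdvantage.Theorems.SignedCubicForrelationInPrBPP.DirectSumDefect

open Finset
open Literature.Computability.QuantumComplexity
open Literature.Computability.QuantumComplexity.BuzetChailloux (bxor zeroVec bxor_comm bxor_self bxor_zeroVec
  zeroVec_bxor bxor_bxor_cancel_left twist_bxor_right twist_zeroVec_right signOf_sq)
open Literature.Computability.QuantumComplexity.Simon (twist_sq twist_eq_one_or)
open Literature.Computability.QuantumComplexity.DerivativeWalsh (dual_affine_on_perp_cosets perp_perp_eq_of_sq
  bxor_mem_perp card_mul_card_perp abs_forrelation_mul_card_le_sqrt forrelation_not_right)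

section DirectSum

variable {N n₀ : ℕ}

/-- **M-subspaces of a direct sum are no larger than products of M-subspaces of the blocks.** For Boolean
`F` on `N` bits and `f₀` on `n₀` bits let `G = F ⊕ f₀` be the direct sum on `N + n₀` bits. If `G` is affine on
every coset of a `⊕`-closed `V ∋ 0` (all second differences of `G` along `V` vanish) then there are `⊕`-closed
`V₁ ∋ 0`, `V₂ ∋ 0` on whose cosets `F` resp. `f₀` are affine, with `|V| ≤ |V₁| · |V₂|`. (The second differences
of `F` along the first projection of `V` are constant and define an alternating form on `V` whose radical contains
`V ∩ (𝔽₂^N ⊕ 0) + V ∩ (0 ⊕ 𝔽₂^{n₀})`; project a large isotropic subgroup to the two blocks.) -/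
theorem exists_factors_of_affine_on_cosets_directSum (F : (Fin N → Bool) → Bool) (f₀ : (Fin n₀ → Bool) → Bool)
    (V : Finset (Fin (N + n₀) → Bool)) (h0 : zeroVec ∈ V) (hadd : ∀ x ∈ V, ∀ y ∈ V, bxor x y ∈ V)
    (hM : ∀ u ∈ V, ∀ v ∈ V, ∀ y : Fin (N + n₀) → Bool,
      ((xor (F fun i => y (Fin.castAdd n₀ i)) (f₀ fun j => y (Fin.natAdd N j))) ^^
        (xor (F fun i => (bxor y u) (Fin.castAdd n₀ i)) (f₀ fun j => (bxor y u) (Fin.natAdd N j))) ^^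
        (xor (F fun i => (bxor y v) (Fin.castAdd n₀ i)) (f₀ fun j => (bxor y v) (Fin.natAdd N j))) ^^
        (xor (F fun i => (bxor y (bxor u v)) (Fin.castAdd n₀ i))
          (f₀ fun j => (bxor y (bxor u v)) (Fin.natAdd N j)))) = false) :
    ∃ V₁ : Finset (Fin N → Bool), ∃ V₂ : Finset (Fin n₀ → Bool),
      (zeroVec ∈ V₁ ∧ (∀ x ∈ V₁, ∀ y ∈ V₁, bxor x y ∈ V₁) ∧
        ∀ u ∈ V₁, ∀ v ∈ V₁, ∀ y, (F y ^^ F (bxor y u) ^^ F (bxor y v) ^^ F (bxor y (bxor u v))) = false) ∧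
      (zeroVec ∈ V₂ ∧ (∀ x ∈ V₂, ∀ y ∈ V₂, bxor x y ∈ V₂) ∧
        ∀ u ∈ V₂, ∀ v ∈ V₂, ∀ y, (f₀ y ^^ f₀ (bxor y u) ^^ f₀ (bxor y v) ^^ f₀ (bxor y (bxor u v))) = false) ∧
      V.card ≤ V₁.card * V₂.card := by
  -- the two projections (additive, jointly injective, jointly surjective)
  set p₁ : (Fin (N + n₀) → Bool) → (Fin N → Bool) := fun y i => y (Fin.castAdd n₀ i) with hp₁
  set p₂ : (Fin (N + n₀) → Bool) → (Fin n₀ → Bool) := fun y j => y (Fin.natAdd N j) with hp₂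
  have hp₁add : ∀ x y, p₁ (bxor x y) = bxor (p₁ x) (p₁ y) := fun _ _ => rfl
  have hp₂add : ∀ x y, p₂ (bxor x y) = bxor (p₂ x) (p₂ y) := fun _ _ => rfl
  have hp₁0 : p₁ zeroVec = zeroVec := rfl
  have hp₂0 : p₂ zeroVec = zeroVec := rfl
  have happ : ∀ y : Fin (N + n₀) → Bool, Fin.append (p₁ y) (p₂ y) = y := fun y =>
    Fin.append_castAdd_natAdd
  have hsurj : ∀ (y₁ : Fin N → Bool) (y₂ : Fin n₀ → Bool), p₁ (Fin.append y₁ y₂) = y₁ ∧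
      p₂ (Fin.append y₁ y₂) = y₂ := fun y₁ y₂ =>
    ⟨funext fun i => Fin.append_left y₁ y₂ i, funext fun j => Fin.append_right y₁ y₂ j⟩
  -- second differences of the blocks agree, hence are constant
  have hsplit : ∀ u ∈ V, ∀ v ∈ V, ∀ (y₁ : Fin N → Bool) (y₂ : Fin n₀ → Bool),
      (F y₁ ^^ F (bxor y₁ (p₁ u)) ^^ F (bxor y₁ (p₁ v)) ^^ F (bxor y₁ (bxor (p₁ u) (p₁ v)))) =
      (f₀ y₂ ^^ f₀ (bxor y₂ (p₂ u)) ^^ f₀ (bxor y₂ (p₂ v)) ^^ f₀ (bxor y₂ (bxor (p₂ u) (p₂ v)))) := by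
    intro u hu v hv y₁ y₂
    have key : ∀ y : Fin (N + n₀) → Bool,
        (F (p₁ y) ^^ F (bxor (p₁ y) (p₁ u)) ^^ F (bxor (p₁ y) (p₁ v)) ^^ F (bxor (p₁ y) (bxor (p₁ u) (p₁ v)))) =
        (f₀ (p₂ y) ^^ f₀ (bxor (p₂ y) (p₂ u)) ^^ f₀ (bxor (p₂ y) (p₂ v)) ^^
          f₀ (bxor (p₂ y) (bxor (p₂ u) (p₂ v)))) :=
      fun y => xor_quad_eq_of_xor_pairs _ _ _ _ _ _ _ _ (hM u hu v hv y)
    have := key (Fin.append y₁ y₂)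
    obtain ⟨e1, e2⟩ := hsurj y₁ y₂
    rwa [e1, e2] at this
  set c : (Fin (N + n₀) → Bool) → (Fin (N + n₀) → Bool) → Bool := fun u v =>
    (F zeroVec ^^ F (bxor zeroVec (p₁ u)) ^^ F (bxor zeroVec (p₁ v)) ^^ F (bxor zeroVec (bxor (p₁ u) (p₁ v))))
    with hc
  have hcF : ∀ u ∈ V, ∀ v ∈ V, ∀ y₁ : Fin N → Bool,
      (F y₁ ^^ F (bxor y₁ (p₁ u)) ^^ F (bxor y₁ (p₁ v)) ^^ F (bxor y₁ (bxor (p₁ u) (p₁ v)))) = c u v := by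
    intro u hu v hv y₁
    rw [hc]; simp only
    rw [hsplit u hu v hv y₁ zeroVec, hsplit u hu v hv zeroVec zeroVec]
  have hcf : ∀ u ∈ V, ∀ v ∈ V, ∀ y₂ : Fin n₀ → Bool,
      (f₀ y₂ ^^ f₀ (bxor y₂ (p₂ u)) ^^ f₀ (bxor y₂ (p₂ v)) ^^ f₀ (bxor y₂ (bxor (p₂ u) (p₂ v)))) = c u v := by
    intro u hu v hv y₂
    rw [← hsplit u hu v hv zeroVec y₂, hcF u hu v hv]
  -- `c` is a symmetric alternating form, additive in the second slot
  have hsymm : ∀ u ∈ V, ∀ v ∈ V, c u v = c v u := by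
    intro u _ v _
    rw [hc]; simp only
    exact sd_comm F zeroVec (p₁ u) (p₁ v)
  have halt : ∀ u ∈ V, c u u = false := by
    intro u _
    rw [hc]; simp only
    exact sd_self F zeroVec (p₁ u)
  have haddr : ∀ u ∈ V, ∀ v ∈ V, ∀ v' ∈ V, c u (bxor v v') = (c u v ^^ c u v') := by
    intro u hu v hv v' hv'
    rw [← hcF u hu (bxor v v') (hadd v hv v' hv') zeroVec, hp₁add, sd_bxor_right,
      hcF u hu v hv zeroVec]
    congr 1
    have := hcF u hu v' hv' (bxor zeroVec (p₁ v))
    rw [← this]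
  -- the radical contains `K₁ ⊕ K₂`
  set K₁ : Finset (Fin (N + n₀) → Bool) := V.filter fun x => p₂ x = zeroVec with hK₁
  set K₂ : Finset (Fin (N + n₀) → Bool) := V.filter fun x => p₁ x = zeroVec with hK₂
  set R : Finset (Fin (N + n₀) → Bool) := (K₁ ×ˢ K₂).image fun ab => bxor ab.1 ab.2 with hR
  have hK₁0 : zeroVec ∈ K₁ := mem_filter.2 ⟨h0, hp₂0⟩
  have hK₂0 : zeroVec ∈ K₂ := mem_filter.2 ⟨h0, hp₁0⟩
  have hRV : R ⊆ V := by
    intro r hr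
    obtain ⟨ab, hab, rfl⟩ := mem_image.1 hr
    obtain ⟨ha, hb⟩ := mem_product.1 hab
    exact hadd _ (mem_filter.1 ha).1 _ (mem_filter.1 hb).1
  have hcK₁ : ∀ a ∈ K₁, ∀ w ∈ V, c a w = false := by
    intro a ha w hw
    obtain ⟨haV, hpa⟩ := mem_filter.1 ha
    rw [← hcf a haV w hw zeroVec, hpa]
    exact sd_zero_left f₀ zeroVec (p₂ w)
  have hcK₂ : ∀ b ∈ K₂, ∀ w ∈ V, c b w = false := by
    intro b hb w hw
    obtain ⟨hbV, hpb⟩ := mem_filter.1 hb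
    rw [← hcF b hbV w hw zeroVec, hpb]
    exact sd_zero_left F zeroVec (p₁ w)
  have haddl : ∀ u ∈ V, ∀ u' ∈ V, ∀ w ∈ V, c (bxor u u') w = (c u w ^^ c u' w) := by
    intro u hu u' hu' w hw
    rw [hsymm _ (hadd u hu u' hu') w hw, haddr w hw u hu u' hu', hsymm w hw u hu, hsymm w hw u' hu']
  have hRrad : ∀ r ∈ R, ∀ w ∈ V, c r w = false := by
    intro r hr w hw
    obtain ⟨ab, hab, rfl⟩ := mem_image.1 hr
    obtain ⟨ha, hb⟩ := mem_product.1 hab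
    rw [haddl _ (mem_filter.1 ha).1 _ (mem_filter.1 hb).1 w hw, hcK₁ _ ha w hw, hcK₂ _ hb w hw]; rfl
  have hRcard : R.card = K₁.card * K₂.card := by
    rw [hR, card_image_of_injOn, card_product]
    rintro ⟨a, b⟩ hab ⟨a', b'⟩ hab' he
    simp only [coe_product, Set.mem_prod, mem_coe] at hab hab'
    obtain ⟨⟨haV, hpa⟩, ⟨hbV, hpb⟩⟩ := And.intro (mem_filter.1 hab.1) (mem_filter.1 hab.2)
    obtain ⟨⟨ha'V, hpa'⟩, ⟨hb'V, hpb'⟩⟩ := And.intro (mem_filter.1 hab'.1) (mem_filter.1 hab'.2)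
    simp only at he
    have h1 : p₁ a = p₁ a' := by
      have := congrArg p₁ he
      rwa [hp₁add, hp₁add, hpb, hpb', bxor_zeroVec, bxor_zeroVec] at this
    have h2 : p₂ b = p₂ b' := by
      have := congrArg p₂ he
      rwa [hp₂add, hp₂add, hpa, hpa', zeroVec_bxor, zeroVec_bxor] at this
    have ea : a = a' := by rw [← happ a, ← happ a', h1, hpa, hpa']
    have eb : b = b' := by rw [← happ b, ← happ b', h2, hpb, hpb']
    rw [ea, eb]
  -- a large isotropic subgroup
  obtain ⟨V₀, hV₀V, hV₀0, hV₀add, hV₀iso, hV₀card⟩ := exists_isotropic_subgroup V.card V le_rfl h0 hadd c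
    hsymm halt haddr R hRV hRrad
  have hV₀V' : ∀ x ∈ V₀, x ∈ V := fun x hx => hV₀V hx
  refine ⟨V₀.image p₁, V₀.image p₂, ⟨?_, ?_, ?_⟩, ⟨?_, ?_, ?_⟩, ?_⟩
  · exact mem_image.2 ⟨zeroVec, hV₀0, hp₁0⟩
  · intro x hx y hy
    obtain ⟨u, hu, rfl⟩ := mem_image.1 hx
    obtain ⟨v, hv, rfl⟩ := mem_image.1 hy
    exact mem_image.2 ⟨bxor u v, hV₀add u hu v hv, hp₁add u v⟩
  · intro x hx y hy y₁
    obtain ⟨u, hu, rfl⟩ := mem_image.1 hx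
    obtain ⟨v, hv, rfl⟩ := mem_image.1 hy
    rw [hcF u (hV₀V' u hu) v (hV₀V' v hv), hV₀iso u hu v hv]
  · exact mem_image.2 ⟨zeroVec, hV₀0, hp₂0⟩
  · intro x hx y hy
    obtain ⟨u, hu, rfl⟩ := mem_image.1 hx
    obtain ⟨v, hv, rfl⟩ := mem_image.1 hy
    exact mem_image.2 ⟨bxor u v, hV₀add u hu v hv, hp₂add u v⟩
  · intro x hx y hy y₂
    obtain ⟨u, hu, rfl⟩ := mem_image.1 hx
    obtain ⟨v, hv, rfl⟩ := mem_image.1 hy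
    rw [hcf u (hV₀V' u hu) v (hV₀V' v hv), hV₀iso u hu v hv]
  · -- counting: |V|·|K₁|·|K₂| ≤ |V₀|² ≤ (|V₀.image p₁|·|K₂⁰|)·(|V₀.image p₂|·|K₁⁰|)
    have h1 := card_le_card_image_mul_card_ker hV₀add p₁ hp₁add
    have h2 := card_le_card_image_mul_card_ker hV₀add p₂ hp₂add
    have hk2 : (V₀.filter fun x => p₁ x = zeroVec).card ≤ K₂.card :=
      card_le_card (filter_subset_filter _ hV₀V)
    have hk1 : (V₀.filter fun x => p₂ x = zeroVec).card ≤ K₁.card :=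
      card_le_card (filter_subset_filter _ hV₀V)
    have hK₁pos : 0 < K₁.card := card_pos.2 ⟨_, hK₁0⟩
    have hK₂pos : 0 < K₂.card := card_pos.2 ⟨_, hK₂0⟩
    rw [hRcard] at hV₀card
    have h3 : V₀.card ^ 2 ≤ ((V₀.image p₁).card * K₂.card) * ((V₀.image p₂).card * K₁.card) := by
      rw [sq]
      exact Nat.mul_le_mul (h1.trans (Nat.mul_le_mul_left _ hk2)) (h2.trans (Nat.mul_le_mul_left _ hk1))
    have h4 : V.card * (K₁.card * K₂.card) ≤
        ((V₀.image p₁).card * (V₀.image p₂).card) * (K₁.card * K₂.card) := by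
      calc V.card * (K₁.card * K₂.card) ≤ V₀.card ^ 2 := hV₀card
        _ ≤ ((V₀.image p₁).card * K₂.card) * ((V₀.image p₂).card * K₁.card) := h3
        _ = ((V₀.image p₁).card * (V₀.image p₂).card) * (K₁.card * K₂.card) := by ring
    exact Nat.le_of_mul_le_mul_right h4 (Nat.mul_pos hK₁pos hK₂pos)

end DirectSum


/-! ### From the dual's affine cosets to an M-subspace; symmetry of `Φ`; sizes without a half-dimensional one -/

section Perp

variable {n : ℕ}

/-- If on every coset `x₀ ⊕ U` the function `a` is affine (a twisted character times a sign), then all second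
differences of `a` along the `⊕`-closed `U` vanish. -/
theorem sd_false_of_affine_twist (a : (Fin n → Bool) → Bool) (U : Finset (Fin n → Bool))
    (hU : ∀ x ∈ U, ∀ y ∈ U, bxor x y ∈ U)
    (haff : ∀ x₀ : Fin n → Bool, ∃ r : Fin n → Bool, ∀ x ∈ U,
      signOf (a (bxor x₀ x)) * twist x r = signOf (a x₀)) :
    ∀ u ∈ U, ∀ v ∈ U, ∀ y, (a y ^^ a (bxor y u) ^^ a (bxor y v) ^^ a (bxor y (bxor u v))) = false := by
  intro u hu v hv y
  obtain ⟨r, hr⟩ := haff y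
  have key : ∀ x ∈ U, signOf (a (bxor y x)) = signOf (a y) * twist x r := by
    intro x hx
    have h := hr x hx
    have ht := twist_sq x r
    calc signOf (a (bxor y x)) = signOf (a (bxor y x)) * twist x r * twist x r := by
          rw [mul_assoc, ← sq, ht, mul_one]
      _ = signOf (a y) * twist x r := by rw [h]
  have huv : twist (bxor u v) r = twist u r * twist v r := by
    rw [twist_comm, twist_bxor_right, twist_comm r u, twist_comm r v]
  have hprod : signOf (a y) * signOf (a (bxor y u)) * signOf (a (bxor y v)) *
      signOf (a (bxor y (bxor u v))) = 1 := by
    rw [key u hu, key v hv, key (bxor u v) (hU u hu v hv), huv]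
    have h0 := signOf_sq (a y)
    have h1 := twist_sq u r
    have h2 := twist_sq v r
    calc signOf (a y) * (signOf (a y) * twist u r) * (signOf (a y) * twist v r) *
          (signOf (a y) * (twist u r * twist v r))
        = (signOf (a y) ^ 2) ^ 2 * (twist u r) ^ 2 * (twist v r) ^ 2 := by ring
      _ = 1 := by rw [h0, h1, h2]; norm_num
  rw [← signOf_xor, ← signOf_xor, ← signOf_xor] at hprod
  revert hprod
  generalize (a y ^^ a (bxor y u) ^^ a (bxor y v) ^^ a (bxor y (bxor u v))) = b
  cases b <;> norm_num [signOf]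

/-- **Half-dimensional M-subspaces pass to the partner of an exact pair.** If `Φ(a,b) = ±1` and `b` is affine on
the cosets of a half-dimensional `⊕`-closed `V ∋ 0`, then `a` is affine on the cosets of the half-dimensional
`V^⊥` (McFarland duality, `dual_affine_on_perp_cosets`). -/
theorem exists_halfdim_of_partner {a b : (Fin n → Bool) → Bool}
    (hΦ : forrelation a b = 1 ∨ forrelation a b = -1) {V : Finset (Fin n → Bool)} (h0 : zeroVec ∈ V)
    (hadd : ∀ x ∈ V, ∀ y ∈ V, bxor x y ∈ V) (hcard : (V.card : ℝ) ^ 2 = (2 : ℝ) ^ n)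
    (hM : ∀ u ∈ V, ∀ v ∈ V, ∀ y, (b y ^^ b (bxor y u) ^^ b (bxor y v) ^^ b (bxor y (bxor u v))) = false) :
    ∃ U : Finset (Fin n → Bool), zeroVec ∈ U ∧ (∀ x ∈ U, ∀ y ∈ U, bxor x y ∈ U) ∧
      (U.card : ℝ) ^ 2 = (2 : ℝ) ^ n ∧
      ∀ u ∈ U, ∀ v ∈ U, ∀ y, (a y ^^ a (bxor y u) ^^ a (bxor y v) ^^ a (bxor y (bxor u v))) = false := by
  obtain ⟨hU0, hUadd⟩ := bxor_mem_perp V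
  refine ⟨_, hU0, hUadd, ?_, sd_false_of_affine_twist a _ hUadd fun x₀ =>
    dual_affine_on_perp_cosets hΦ h0 hadd hcard hM x₀⟩
  rw [(perp_perp_eq_of_sq h0 hadd hcard).2, hcard]

/-- `Φ` is symmetric. -/
theorem forrelation_symm (f g : (Fin n → Bool) → Bool) : forrelation g f = forrelation f g := by
  unfold forrelation
  congr 1
  rw [sum_comm]
  refine sum_congr rfl fun x _ => sum_congr rfl fun y _ => ?_
  rw [twist_comm y x]; ring

/-- Complementing a function does not change its second differences. -/
theorem sd_not (g : (Fin n → Bool) → Bool) (y u v : Fin n → Bool) :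
    ((!g y) ^^ (!g (bxor y u)) ^^ (!g (bxor y v)) ^^ (!g (bxor y (bxor u v)))) =
      (g y ^^ g (bxor y u) ^^ g (bxor y v) ^^ g (bxor y (bxor u v))) := by
  generalize g y = p; generalize g (bxor y u) = q; generalize g (bxor y v) = r
  generalize g (bxor y (bxor u v)) = s
  revert p q r s; decide

/-- **Size of M-subspaces of an exact pair without a half-dimensional one.** If `Φ(f,g) = 1` on `m + m` bits and
`g` has NO half-dimensional M-subspace, then every M-subspace of `g` AND every M-subspace of `f` has at most
`2^m / 2` elements (`|V|` is a power of two dividing `2ⁿ`, `|Φ|·|V| ≤ 2^m`, and duality). -/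
theorem card_MSubspace_le_of_no_halfdim {m : ℕ} (f g : (Fin (m + m) → Bool) → Bool)
    (hΦ : forrelation f g = 1)
    (hno : ¬ ∃ V : Finset (Fin (m + m) → Bool), zeroVec ∈ V ∧ (∀ x ∈ V, ∀ y ∈ V, bxor x y ∈ V) ∧
      (V.card : ℝ) ^ 2 = (2 : ℝ) ^ (m + m) ∧
      ∀ u ∈ V, ∀ v ∈ V, ∀ y, (g y ^^ g (bxor y u) ^^ g (bxor y v) ^^ g (bxor y (bxor u v))) = false) :
    (∀ V : Finset (Fin (m + m) → Bool), zeroVec ∈ V → (∀ x ∈ V, ∀ y ∈ V, bxor x y ∈ V) →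
      (∀ u ∈ V, ∀ v ∈ V, ∀ y, (g y ^^ g (bxor y u) ^^ g (bxor y v) ^^ g (bxor y (bxor u v))) = false) →
      V.card * 2 ≤ 2 ^ m) ∧
    (∀ V : Finset (Fin (m + m) → Bool), zeroVec ∈ V → (∀ x ∈ V, ∀ y ∈ V, bxor x y ∈ V) →
      (∀ u ∈ V, ∀ v ∈ V, ∀ y, (f y ^^ f (bxor y u) ^^ f (bxor y v) ^^ f (bxor y (bxor u v))) = false) →
      V.card * 2 ≤ 2 ^ m) := by
  -- generic step: an M-subspace of the second slot of an exact pair on `m+m` bits is small or half-dimensional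
  have step : ∀ (a b : (Fin (m + m) → Bool) → Bool), forrelation a b = 1 →
      ∀ V : Finset (Fin (m + m) → Bool), zeroVec ∈ V → (∀ x ∈ V, ∀ y ∈ V, bxor x y ∈ V) →
      (∀ u ∈ V, ∀ v ∈ V, ∀ y, (b y ^^ b (bxor y u) ^^ b (bxor y v) ^^ b (bxor y (bxor u v))) = false) →
      V.card * 2 ≤ 2 ^ m ∨ (V.card : ℝ) ^ 2 = (2 : ℝ) ^ (m + m) := by
    intro a b hab V h0 hadd hM
    -- `|V|` divides `2^(m+m)`
    have hdvd : V.card ∣ 2 ^ (m + m) := by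
      have h := card_mul_card_perp h0 hadd
      have h' : V.card * (univ.filter fun y => ∀ x ∈ V, twist x y = 1).card = 2 ^ (m + m) := by
        exact_mod_cast h
      exact Dvd.intro _ h'
    obtain ⟨j, _, hj⟩ := (Nat.dvd_prime_pow Nat.prime_two).1 hdvd
    -- `|V| ≤ 2^m`
    have hle : (V.card : ℝ) ≤ (2 : ℝ) ^ m := by
      have h := abs_forrelation_mul_card_le_sqrt a b h0 hadd hM
      rw [hab, abs_one, one_mul, pow_add, Real.sqrt_mul_self (by positivity)] at h
      exact h
    have hjm : j ≤ m := by
      rw [hj] at hle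
      have : (2 : ℝ) ^ j ≤ (2 : ℝ) ^ m := by exact_mod_cast hle
      exact (pow_le_pow_iff_right₀ (by norm_num : (1 : ℝ) < 2)).1 this
    rcases Nat.lt_or_ge j m with hlt | hge
    · left
      rw [hj, ← pow_succ]
      exact Nat.pow_le_pow_right (by norm_num) hlt
    · right
      have hjm' : j = m := le_antisymm hjm hge
      rw [hj, hjm']
      push_cast
      rw [← pow_mul, pow_add]; ring
  refine ⟨fun V h0 hadd hM => ?_, fun V h0 hadd hM => ?_⟩
  · rcases step f g hΦ V h0 hadd hM with h | h
    · exact h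
    · exact (hno ⟨V, h0, hadd, h, hM⟩).elim
  · have hΦ' : forrelation g f = 1 := by rw [forrelation_symm]; exact hΦ
    rcases step g f hΦ' V h0 hadd hM with h | h
    · exact h
    · obtain ⟨U, hU0, hUadd, hUcard, hUM⟩ := exists_halfdim_of_partner (Or.inl hΦ') h0 hadd h hM
      exact (hno ⟨U, hU0, hUadd, hUcard, hUM⟩).elim

end Perp

end Summit.QuantumAdvantage.QuantumAdvantage.Theorems.SignedCubicForrelationInPrBPP.DirectSumDefect

end
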